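import Mathlib
import Literature.Computability.AlgebraicComplexity.SimultaneousDoubleProduct
import Literature.Computability.AlgebraicComplexity.PrattTrapezoidValSDPP
import Literature.Computability.AlgebraicComplexity.GroupTheoreticMatMulThmBProofs
import Literature.Combinatorics.Additive.TightTriangleRemovalProofs

/-!
# The CKSU two-families design lift with homocyclic output — stub `stub_designLift` of line
`registered` (crux `EisensteinValCertificates.HomocyclicSTPPDesigns`, stmt-MatrixMultiplication-10647)

The Cohn–Kleinberg–Szegedy–Umans SDPP-to-STPP lift (CKSU 2005 §4 Def. 4.1 and §6.2; recalled in
the proof of Pratt 2024, Thm. 4.7) as a DESIGN-PRODUCING lemma whose output lives in the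
homocyclic host `Fin 3 → H`: for every `δ > 0` there is a threshold `n₁` such that for all
`n ≥ n₁`, every family of `n` pairs `(A_i, B_i)` with the simultaneous double product property
(tree `IsSDPP`) in an abelian group `H` yields an STPP family (tree `IsSTPP`) of `N ≥ n^{2-δ}`
triples in `Fin 3 → H`, each with size product `(|A_i||B_i|)(|A_j||B_j|)(|A_k||B_k|)` for some
indices `i j k`.

Proof (all tree lemmas): with `η := min δ 1 / 2` take the Behrend corner-free index maps
`j₁ j₂ j₃ : ι₀ → Fin n` of `exists_cornerFree_indexMaps_card_ge` (`n^{2-η} ≤ 64 |ι₀|`); the CKSU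
family `A_{j₁ x} × {0} × B_{j₃ x}`, `B_{j₁ x} × A_{j₂ x} × {0}`, `{0} × B_{j₂ x} × A_{j₃ x}` is an
`AddSimultaneousTPP` family in `H × H × H` (`addSimultaneousTPP_of_sdpp`); reindex it by
`Fin |ι₀| ≃ ι₀` (`AddSimultaneousTPP.comp`), convert (`isSTPP_iff_addSimultaneousTPP`) and push it
forward along the injective additive hom `(x, y, z) ↦ ![x, y, z] : H × H × H →+ (Fin 3 → H)`
(`IsSTPP.image`, `Finset.card_image_of_injective`). Finally `n^{2-δ} ≤ |ι₀|` for `n` large,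
because `64 ≤ n^{δ-η}` eventually (`tendsto_rpow_atTop`) and `n^{2-η} = n^{δ-η} · n^{2-δ}`.

Sources: H. Cohn, R. Kleinberg, B. Szegedy, C. Umans, *Group-theoretic algorithms for matrix
multiplication*, FOCS 2005, §4 Def. 4.1, §6.2; K. Pratt, *On generalized corners and matrix
multiplication*, ITCS 2024, proof of Thm. 4.7. Not here: any SDPP family (that is the open item
`FourierTwoFamiliesModP.PrimeTwoFamilies`, stmt-MatrixMultiplication-14308) and the exponent count
composing the two into the crux.
-/

set_option linter.dupNamespace false
-- (single-conjunct summit: the namespace repeats `MatrixMultiplication`)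

namespace Summit.MatrixMultiplication.MatrixMultiplication.Theorems.HomocyclicSTPPDesigns.DesignLift

open Literature.Computability.AlgebraicComplexity

/-- **The CKSU design lift with homocyclic output** (registered stub `stub_designLift` of line
`registered`): for every `δ > 0` there is `n₁` such that for all `n ≥ n₁`, every SDPP family of
`n` pairs `(A_i, B_i)` in an abelian group `H` yields an STPP family `(A'_v, B'_v, C'_v)_{v<N}` in
`Fin 3 → H` with `n^{2-δ} ≤ N` and
`|A'_v||B'_v||C'_v| = (|A_i||B_i|)(|A_j||B_j|)(|A_k||B_k|)` for some `i j k` (depending on `v`).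
The family is the CKSU 2005 §6.2 construction `A_{v₁} × {0} × B_{v₃}`, `B_{v₁} × A_{v₂} × {0}`,
`{0} × B_{v₂} × A_{v₃}` over a Behrend corner-free index set, transported from `H × H × H` to
`Fin 3 → H` along `(x, y, z) ↦ ![x, y, z]`.
[cite: CohnKleinbergSzegedyUmans2005, §6.2] -/
theorem stub_designLift :
    ∀ δ : ℝ, 0 < δ → ∃ n₁ : ℕ, ∀ n ≥ n₁, ∀ (H : Type) [AddCommGroup H]
      (A B : Fin n → Finset H), IsSDPP A B →
      ∃ (N : ℕ) (A' B' C' : Fin N → Finset (Fin 3 → H)),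
        IsSTPP A' B' C' ∧ (n : ℝ) ^ (2 - δ) ≤ N ∧
        ∀ v : Fin N, ∃ i j k : Fin n,
          (A' v).card * (B' v).card * (C' v).card =
            ((A i).card * (B i).card) * ((A j).card * (B j).card) * ((A k).card * (B k).card) := by
  intro δ hδ
  -- the Behrend exponent `η`, with `0 < η ≤ 1` and `η < δ`
  obtain ⟨η, hη, hη1, hδη⟩ : ∃ η : ℝ, 0 < η ∧ η ≤ 1 ∧ 0 < δ - η := by
    have h0 : 0 < min δ 1 := lt_min hδ one_pos
    have h1 : min δ 1 ≤ 1 := min_le_right δ 1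
    have h2 : min δ 1 ≤ δ := min_le_left δ 1
    exact ⟨min δ 1 / 2, by linarith, by linarith, by linarith⟩
  -- corner-free index configurations (Behrend)
  obtain ⟨n₁, hn₁⟩ := exists_cornerFree_indexMaps_card_ge η hη hη1
  -- the threshold beyond which `64 ≤ n ^ (δ - η)`
  obtain ⟨n₂, hn₂⟩ : ∃ n₂ : ℕ, ∀ n ≥ n₂, (64 : ℝ) ≤ (n : ℝ) ^ (δ - η) := by
    have h := ((tendsto_rpow_atTop hδη).comp tendsto_natCast_atTop_atTop).eventually
      (Filter.eventually_ge_atTop (64 : ℝ))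
    obtain ⟨n₂, hn₂⟩ := Filter.eventually_atTop.1 h
    exact ⟨n₂, hn₂⟩
  refine ⟨n₁ + n₂ + 1, fun n hn H _ A B hSD => ?_⟩
  classical
  -- the corner-free index maps into `Fin n`
  obtain ⟨ι₀, _inst1, _inst2, j₁, j₂, j₃, hι₀, hcf⟩ := hn₁ n (by omega)
  -- the CKSU STPP family in `H × H × H`
  have hS := addSimultaneousTPP_of_sdpp hSD.1 hSD.2 j₁ j₂ j₃ hcf
  set N : ℕ := Fintype.card ι₀ with hN
  set e : Fin N ≃ ι₀ := (Fintype.equivFin ι₀).symm with he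
  have hS' := hS.comp e.injective
  set A₀ : Fin N → Finset (H × H × H) :=
    fun y => A (j₁ (e y)) ×ˢ (({0} : Finset H) ×ˢ B (j₃ (e y))) with hA₀
  set B₀ : Fin N → Finset (H × H × H) :=
    fun y => B (j₁ (e y)) ×ˢ (A (j₂ (e y)) ×ˢ ({0} : Finset H)) with hB₀
  set C₀ : Fin N → Finset (H × H × H) :=
    fun y => ({0} : Finset H) ×ˢ (B (j₂ (e y)) ×ˢ A (j₃ (e y))) with hC₀
  have hSTPP : IsSTPP A₀ B₀ C₀ := (isSTPP_iff_addSimultaneousTPP A₀ B₀ C₀).2 hS'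
  -- an injective additive hom `H × H × H →+ (Fin 3 → H)`
  obtain ⟨f, hf⟩ : ∃ f : H × H × H →+ (Fin 3 → H), Function.Injective f := by
    refine ⟨{ toFun := fun x => ![x.1, x.2.1, x.2.2]
              map_zero' := ?_
              map_add' := ?_ }, ?_⟩
    · funext t
      fin_cases t <;> rfl
    · intro x y
      funext t
      fin_cases t <;> rfl
    · intro x y h
      simp only [AddMonoidHom.coe_mk, ZeroHom.coe_mk] at h
      have h0 := congrFun h 0
      have h1 := congrFun h 1
      have h2 := congrFun h 2
      simp only [Matrix.cons_val_zero, Matrix.cons_val_one, Matrix.cons_val] at h0 h1 h2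
      exact Prod.ext h0 (Prod.ext h1 h2)
  -- the transported family in `Fin 3 → H`
  refine ⟨N, fun v => (A₀ v).image f, fun v => (B₀ v).image f, fun v => (C₀ v).image f,
    hSTPP.image f hf, ?_, ?_⟩
  · -- `n ^ (2 - δ) ≤ N`
    have hnpos : (0 : ℝ) < n := by exact_mod_cast (show 0 < n by omega)
    have h64 : (64 : ℝ) ≤ (n : ℝ) ^ (δ - η) := hn₂ n (by omega)
    have hsplit : (n : ℝ) ^ (2 - η) = (n : ℝ) ^ (δ - η) * (n : ℝ) ^ (2 - δ) := by
      rw [← Real.rpow_add hnpos]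
      congr 1
      ring
    have hnn : 0 ≤ (n : ℝ) ^ (2 - δ) := Real.rpow_nonneg hnpos.le _
    have h1 : 64 * (n : ℝ) ^ (2 - δ) ≤ 64 * (N : ℝ) :=
      calc 64 * (n : ℝ) ^ (2 - δ) ≤ (n : ℝ) ^ (δ - η) * (n : ℝ) ^ (2 - δ) :=
            mul_le_mul_of_nonneg_right h64 hnn
        _ = (n : ℝ) ^ (2 - η) := hsplit.symm
        _ ≤ 64 * (N : ℝ) := hι₀
    exact le_of_mul_le_mul_left h1 (by norm_num)
  · -- sizes
    intro v
    refine ⟨j₁ (e v), j₂ (e v), j₃ (e v), ?_⟩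
    simp only [Finset.card_image_of_injective _ hf, hA₀, hB₀, hC₀, Finset.card_product,
      Finset.card_singleton]
    ring

end Summit.MatrixMultiplication.MatrixMultiplication.Theorems.HomocyclicSTPPDesigns.DesignLift
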